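import Mathlib
import HarnessLib
import Literature.MathematicalPhysics.QuantumFieldTheory.PointwiseOSReconstruction
import Summits.CriticalPhenomena.Ising3DConformalLimit.Theses.ModularQuarterTurn
import Summits.CriticalPhenomena.Ising3DConformalLimit.Theorems.ModularQuarterTurnToroidalInversionUpgradeGeometry

/-!
# `ToroidalInversionUpgrade` (route `ModularQuarterTurn`, item stmt-CriticalPhenomena-6497): PROOF

The support item "group bookkeeping for inversion" of the route: if `S` is a normalised,
Euclidean-invariant, scale-covariant (`Δ > 0`) pointwise scaling limit of the critical `ℤ³` Ising
correlators and, for every `r > 0`, the conformally weighted correlator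
`(∏ᵢ Jᵢ)^Δ · S n (M_{ψᵢ}(aᵢ, bᵢ))ᵢ` (elliptic Möbius rotations `M_ψ` about the rim circle
`{x₂ = 0, |x| = r}`, `ψᵢ = c + Σ_{j<i} φⱼ`) does not depend on the common toroidal offset `c` on the
disc domain, then `S` is covariant under the unit inversion (`IsInversionCovariant Δ S`) — literally
the route decl `Summit.CriticalPhenomena.Ising3DConformalLimit.Theses.ModularQuarterTurn.ToroidalInversionUpgrade`
(`toroidalInversionUpgrade_proof`).

Proof (pure Möbius geometry plus bookkeeping, as announced in the route):
* permutation symmetry of `S` from the lattice (`perm_symm`);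
* a generic Householder reflection moves the configuration off the `x₂`-axis
  (`exists_isometry_off_axis`), and `r := 1 + Σ‖xᵢ‖` puts every point strictly inside the ball of
  radius `r`, hence off the rim circle;
* the closed-form inverse toroidal map of the companion file `…Geometry` writes each point as
  `M_{θᵢ}(aᵢ, bᵢ)`; sorting the angles `θᵢ ∈ (-π, π]` (`Tuple.sort`) gives gaps `φᵢ ≥ 0`, `Σφ = 2π`
  (`gaps`); injectivity of the parametrisation (`Mf_injective`) gives the offset-free non-coincidence;
* the hypothesis at the offsets `(θ₀, θ₀ + π)` reads `(∏J)^Δ S(y) = (∏ J r²/‖y‖²)^Δ S(r² θ₂ ι y)`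
  (`M_{ψ+π} = ι_r ∘ θ₂`: `Mf_neg_cf_neg_sf`, `Jf_neg_cf`), and scale covariance (`r²`), rotation
  invariance (`θ₂`, the generic reflection) and permutation symmetry give
  `S(ι x) = ∏‖xᵢ‖^{2Δ} S(x)` (`bookkeeping`).
References: P. D. Hislop, R. Longo, Comm. Math. Phys. 84 (1982) 71–85, §2 (the modular flow of a
double cone; here its Euclidean section, the elliptic rotations about a circle); Di Francesco–
Mathieu–Sénéchal (1997) §4.1 (Möbius group of `ℝ^d`). No definitions are introduced here.
-/

noncomputable section

open Literature.MathematicalPhysics.QuantumFieldTheory (axisReflection axisReflection_apply)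

namespace Summit.CriticalPhenomena.Ising3DConformalLimit.ModularQuarterTurnToroidal

/-! ## Bookkeeping lemmas for the upgrade -/

section Upgrade

/-- INJECTIVITY of the toroidal parametrisation in `(cos ψ, sin ψ, a, b)` on the punctured disc.
[folklore] -/
theorem Mf_injective {r : ℝ} (hr : 0 < r) {c s a b c' s' a' b' : ℝ} (hcs : c ^ 2 + s ^ 2 = 1)
    (hab : 0 < a ^ 2 + b ^ 2) (habr : a ^ 2 + b ^ 2 < r ^ 2) (hcs' : c' ^ 2 + s' ^ 2 = 1)
    (hab' : 0 < a' ^ 2 + b' ^ 2) (habr' : a' ^ 2 + b' ^ 2 < r ^ 2)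
    (h : Mf r c s a b = Mf r c' s' a' b') : c = c' ∧ s = s' ∧ a = a' ∧ b = b' := by
  obtain ⟨-, -, ha, hb, hc, hs⟩ := backward hr hcs hab habr
  obtain ⟨-, -, ha', hb', hc', hs'⟩ := backward hr hcs' hab' habr'
  rw [h] at ha hb hc hs
  exact ⟨hc.symm.trans hc', hs.symm.trans hs', ha.symm.trans ha', hb.symm.trans hb'⟩


open Literature.Probability.LatticeModels EuclideanGeometry Filter Topology
open Summit.CriticalPhenomena.Ising3DConformalLimit.Theses.ModularQuarterTurn

/-- Permutation symmetry of a normalised pointwise scaling limit of `criticalCorr 3`: exact on the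
lattice (the spin monomial is a commutative product), inherited by the limit (uniqueness of limits
along `𝓝[>] 0`), trivial off `NonCoincident` by the normalisation. [folklore] -/
theorem perm_symm {ρ : ℝ → ℝ} {S : CorrFamily 3}
    (hlim : HasPointwiseScalingLimit (criticalCorr 3) ρ S)
    (hnorm : ∀ n z, z ∉ NonCoincident 3 n → S n z = 0)
    (n : ℕ) (σ : Equiv.Perm (Fin n)) (x : Fin n → EuclideanSpace ℝ (Fin 3)) :
    S n (x ∘ σ) = S n x := by
  have hresc : ∀ δ, rescaledCorrelator (criticalCorr 3) ρ n δ (x ∘ σ) =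
      rescaledCorrelator (criticalCorr 3) ρ n δ x := by
    intro δ
    simp only [rescaledCorrelator_apply, Function.comp_apply]
    congr 1
    show plusExpect 3 (criticalBeta 3) 0 (spinMonomial _) =
      plusExpect 3 (criticalBeta 3) 0 (spinMonomial _)
    congr 1
    funext s
    unfold spinMonomial
    exact Fintype.prod_equiv σ _ _ fun i => rfl
  by_cases hx : Function.Injective x
  · have hxσ : (x ∘ σ) ∈ NonCoincident 3 n := hx.comp σ.injective
    exact tendsto_nhds_unique (((hlim n).tendsto_at hxσ).congr hresc)
      ((hlim n).tendsto_at (show x ∈ NonCoincident 3 n from hx))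
  · have hxσ : ¬ Function.Injective (x ∘ σ) := fun h =>
      hx ((Function.Injective.of_comp_iff' x σ.bijective).1 h)
    rw [hnorm n _ hxσ, hnorm n _ hx]

/-- Gap angles from sorted toroidal angles: for a monotone `θ : Fin (m+1) → (-π, π]` there are gaps
`φ i ≥ 0` with `∑ φ = 2π` whose partial sums are `θ i - θ 0` (telescoping; the last gap closes the
circle). [folklore] -/
theorem gaps {m : ℕ} (θ : Fin (m + 1) → ℝ) (hmono : Monotone θ) (hlo : ∀ i, -Real.pi < θ i)
    (hhi : ∀ i, θ i ≤ Real.pi) :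
    ∃ φ : Fin (m + 1) → ℝ, (∀ i, 0 ≤ φ i) ∧ ∑ i, φ i = 2 * Real.pi ∧
      ∀ i : Fin (m + 1), ∑ j, (if j < i then φ j else 0) = θ i - θ 0 := by
  set g : ℕ → ℝ := fun k => if h : k < m + 1 then θ ⟨k, h⟩ else θ 0 + 2 * Real.pi with hg
  have hgval : ∀ i : Fin (m + 1), g i.val = θ i := fun i => by
    simp only [hg, dif_pos i.isLt, Fin.eta]
  have hgtop : g (m + 1) = θ 0 + 2 * Real.pi := by
    simp only [hg, dif_neg (lt_irrefl (m + 1))]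
  have hg0 : g 0 = θ 0 := hgval 0
  refine ⟨fun j => g (j.val + 1) - g j.val, ?_, ?_, ?_⟩
  · intro j
    show 0 ≤ g (j.val + 1) - g j.val
    by_cases hj : j.val + 1 < m + 1
    · have h1 : g (j.val + 1) = θ ⟨j.val + 1, hj⟩ := by simp only [hg, dif_pos hj]
      rw [h1, hgval, sub_nonneg]
      exact hmono (Fin.le_iff_val_le_val.2 (Nat.le_succ _))
    · have hj' : j.val + 1 = m + 1 := by omega
      rw [hj', hgtop, hgval]
      linarith [hlo 0, hhi j]
  · rw [Fin.sum_univ_eq_sum_range (fun k => g (k + 1) - g k) (m + 1), Finset.sum_range_sub, hgtop,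
      hg0]
    ring
  · intro i
    have hi := i.isLt
    calc ∑ j : Fin (m + 1), (if j < i then g (j.val + 1) - g j.val else 0)
        = ∑ k ∈ Finset.range (m + 1), (if k < i.val then g (k + 1) - g k else 0) := by
          rw [← Fin.sum_univ_eq_sum_range (fun k => if k < i.val then g (k + 1) - g k else 0) (m + 1)]
          refine Finset.sum_congr rfl fun j _ => ?_
          simp only [Fin.lt_def]
      _ = ∑ k ∈ Finset.range i.val, (g (k + 1) - g k) := by
          rw [Finset.sum_ite, Finset.sum_const_zero, add_zero]
          refine Finset.sum_congr ?_ fun _ _ => rfl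
          ext k
          simp only [Finset.mem_filter, Finset.mem_range]
          omega
      _ = g i.val - g 0 := Finset.sum_range_sub _ _
      _ = θ i - θ 0 := by rw [hgval, hg0]

/-- A generic orthogonal map moving finitely many non-zero points off the `x₂`-axis: the Householder
reflection taking a unit vector `u ∦ xᵢ` (all `i`) to `e₂`. [folklore] -/
theorem exists_isometry_off_axis {n : ℕ} (x : Fin n → EuclideanSpace ℝ (Fin 3)) (hx : ∀ i, x i ≠ 0) :
    ∃ R : EuclideanSpace ℝ (Fin 3) ≃ₗᵢ[ℝ] EuclideanSpace ℝ (Fin 3),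
      ∀ i, 0 < (R (x i)) 0 ^ 2 + (R (x i)) 1 ^ 2 := by
  classical
  obtain ⟨s, hs⟩ := Infinite.exists_notMem_finset (Finset.univ.image fun i => x i 0 / x i 1)
  set e : EuclideanSpace ℝ (Fin 3) := !₂[s, 1, 0] with he_def
  have he0 : e 0 = s := by simp [he_def]
  have he1 : e 1 = 1 := by simp [he_def]
  have hepos : 0 < ‖e‖ := by
    refine norm_pos_iff.2 fun h => ?_
    have h1 : e 1 = 0 := by rw [h]; rfl
    rw [he1] at h1
    exact one_ne_zero h1
  set u : EuclideanSpace ℝ (Fin 3) := ‖e‖⁻¹ • e with hu_def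
  have hu : ‖u‖ = 1 := by
    rw [hu_def, norm_smul, norm_inv, norm_norm, inv_mul_cancel₀ hepos.ne']
  set e₂ : EuclideanSpace ℝ (Fin 3) := !₂[0, 0, 1] with he₂_def
  have he₂ : ‖e₂‖ = 1 := by
    rw [EuclideanSpace.norm_eq, Fin.sum_univ_three]
    simp [he₂_def]
  set R := (ℝ ∙ (u - e₂))ᗮ.reflection with hR
  have hRu : R u = e₂ := Submodule.reflection_sub (by rw [hu, he₂])
  have hRe₂ : R e₂ = u := by
    have h := congrArg R hRu
    rw [Submodule.reflection_reflection] at h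
    exact h.symm
  refine ⟨R, fun i => ?_⟩
  by_contra hneg
  have h0 : R (x i) 0 = 0 := by nlinarith [sq_nonneg (R (x i) 0), sq_nonneg (R (x i) 1)]
  have h1 : R (x i) 1 = 0 := by nlinarith [sq_nonneg (R (x i) 0), sq_nonneg (R (x i) 1)]
  set μ := R (x i) 2 with hμ_def
  have hRx : R (x i) = μ • e₂ := by
    ext k
    fin_cases k
    · show R (x i) 0 = (μ • e₂) 0
      simp [he₂_def, h0]
    · show R (x i) 1 = (μ • e₂) 1
      simp [he₂_def, h1]
    · show R (x i) 2 = (μ • e₂) 2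
      simp [he₂_def, hμ_def]
  have hxi : x i = μ • u := by
    have h := congrArg R hRx
    rw [Submodule.reflection_reflection, LinearIsometryEquiv.map_smul, hRe₂] at h
    exact h
  have hμ : μ ≠ 0 := by
    intro h
    apply hx i
    rw [hxi, h, zero_smul]
  apply hs
  rw [Finset.mem_image]
  refine ⟨i, Finset.mem_univ _, ?_⟩
  have hx0 : x i 0 = μ * (‖e‖⁻¹ * s) := by
    rw [hxi, hu_def, PiLp.smul_apply, PiLp.smul_apply, he0, smul_eq_mul, smul_eq_mul]
  have hx1 : x i 1 = μ * (‖e‖⁻¹ * 1) := by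
    rw [hxi, hu_def, PiLp.smul_apply, PiLp.smul_apply, he1, smul_eq_mul, smul_eq_mul]
  rw [hx0, hx1]
  have hne : ‖e‖ ≠ 0 := hepos.ne'
  field_simp

/-- The real-power bookkeeping of the upgrade: cancelling the conformal factors. [folklore] -/
theorem bookkeeping {n : ℕ} {Δ c A B : ℝ} (hc : 0 < c) (f g : Fin n → ℝ) (hf : ∀ i, 0 < f i)
    (hg : ∀ i, 0 < g i)
    (h : (∏ i, f i) ^ Δ * A = (∏ i, (f i * (c / g i))) ^ Δ * (c ^ (-(n : ℝ) * Δ) * B)) :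
    B = (∏ i, g i ^ Δ) * A := by
  have hF : 0 < ∏ i, f i := Finset.prod_pos fun i _ => hf i
  have hG : 0 < ∏ i, g i := Finset.prod_pos fun i _ => hg i
  rw [Finset.prod_mul_distrib,
    Real.mul_rpow hF.le (Finset.prod_nonneg fun i _ => (div_pos hc (hg i)).le), mul_assoc] at h
  have h2 := mul_left_cancel₀ (Real.rpow_pos_of_pos hF Δ).ne' h
  rw [Finset.prod_div_distrib, Finset.prod_const, Finset.card_univ, Fintype.card_fin,
    Real.div_rpow (pow_nonneg hc.le n) hG.le] at h2
  have h3 : (c ^ n) ^ Δ * c ^ (-(n : ℝ) * Δ) = 1 := by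
    rw [← Real.rpow_natCast c n, ← Real.rpow_mul hc.le, ← Real.rpow_add hc,
      show (n : ℝ) * Δ + -(n : ℝ) * Δ = 0 by ring, Real.rpow_zero]
  have hGΔ : 0 < (∏ i, g i) ^ Δ := Real.rpow_pos_of_pos hG Δ
  have h4 : A = B / (∏ i, g i) ^ Δ := by
    rw [h2, div_mul_eq_mul_div, ← mul_assoc, h3, one_mul]
  rw [h4, Real.finsetProd_rpow _ _ (fun i _ => (hg i).le)]
  field_simp

/-- The unit inversion of `ℝ³` is `v ↦ ‖v‖⁻² • v`. [folklore] -/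
theorem inversion_zero_one_eq (v : EuclideanSpace ℝ (Fin 3)) :
    inversion 0 1 v = (‖v‖ ^ 2)⁻¹ • v := by
  rw [inversion, dist_eq_norm, vsub_eq_sub, sub_zero, vadd_eq_add, add_zero, div_pow, one_pow,
    one_div]

/-- The unit inversion commutes with linear isometries. [folklore] -/
theorem inversion_map (R : EuclideanSpace ℝ (Fin 3) ≃ₗᵢ[ℝ] EuclideanSpace ℝ (Fin 3))
    (v : EuclideanSpace ℝ (Fin 3)) : inversion 0 1 (R v) = R (inversion 0 1 v) := by
  rw [inversion_zero_one_eq, inversion_zero_one_eq, LinearIsometryEquiv.norm_map,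
    LinearIsometryEquiv.map_smul]

/-- **`ToroidalInversionUpgrade`** (item stmt-CriticalPhenomena-6497 of route `ModularQuarterTurn`):
offset-independence of `(∏ J)^Δ · S ∘ M_ψ` on the disc domain upgrades a normalised, Euclidean-invariant,
scale-covariant limit `S` to an inversion-covariant one.  Proof: move the configuration off the
`x₂`-axis by a generic orthogonal map, take `r` larger than all norms, read off toroidal coordinates
(`Mf_cf_sf`), sort the angles and build the gaps (`gaps`); the hypothesis at offsets `(θ₀, θ₀ + π)` is
`S(y) ∏J^Δ = S(r² θ₂ ι y) ∏(J r²/‖y‖²)^Δ` (`Mf_neg_cf_neg_sf`, `Jf_neg_cf`), and scale covariance,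
`θ₂`-invariance and permutation symmetry finish. [folklore] -/
theorem toroidalInversionUpgrade_proof : ToroidalInversionUpgrade := by
  intro ρ Δ S hρ hΔ hlim hnorm hnd heuc hsc H n x hx
  rcases heuc with ⟨htr, hrot⟩
  by_cases hinj : Function.Injective x
  swap
  · have h1 : ¬ Function.Injective (fun i => inversion (0 : EuclideanSpace ℝ (Fin 3)) 1 (x i)) :=
      fun h => hinj fun i j hij => h (show inversion 0 1 (x i) = inversion 0 1 (x j) by rw [hij])
    rw [hnorm n _ h1, hnorm n _ hinj, mul_zero]
  cases n with
  | zero =>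
    have h0 : (fun i : Fin 0 => inversion (0 : EuclideanSpace ℝ (Fin 3)) 1 (x i)) = x :=
      funext fun i => i.elim0
    rw [h0, Finset.univ_eq_empty, Finset.prod_empty, one_mul]
  | succ m =>
    -- a generic orthogonal map and a large radius
    obtain ⟨R, hR⟩ := exists_isometry_off_axis x hx
    set r : ℝ := 1 + ∑ i, ‖x i‖ with hr_def
    have hr : 0 < r := by positivity
    have hr2 : 0 < r ^ 2 := by positivity
    have hnorm_lt : ∀ i, ‖R (x i)‖ < r := by
      intro i
      rw [LinearIsometryEquiv.norm_map]
      have : ‖x i‖ ≤ ∑ j, ‖x j‖ :=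
        Finset.single_le_sum (fun j _ => norm_nonneg (x j)) (Finset.mem_univ i)
      linarith
    -- sorted toroidal angles
    set θ₀ : Fin (m + 1) → ℝ := fun i => angf r (R (x i)) with hθ₀
    set σ : Equiv.Perm (Fin (m + 1)) := Tuple.sort θ₀ with hσ
    set y : Fin (m + 1) → EuclideanSpace ℝ (Fin 3) := fun i => R (x (σ i)) with hy
    set θ : Fin (m + 1) → ℝ := fun i => angf r (y i) with hθ
    have hθmono : Monotone θ := Tuple.monotone_sort θ₀
    have hyinj : Function.Injective y := fun i j hij => σ.injective (hinj (R.injective hij))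
    have hyρ : ∀ i, 0 < (y i) 0 ^ 2 + (y i) 1 ^ 2 := fun i => hR (σ i)
    have hynsq : ∀ i, 0 < nsq (y i) := fun i => by
      unfold nsq; nlinarith [hyρ i, sq_nonneg ((y i) 2)]
    have hyD : ∀ i, 0 < disc r (y i) := by
      intro i
      have h1 : nsq (y i) < r ^ 2 := by
        rw [nsq_eq_norm_sq]
        exact pow_lt_pow_left₀ (hnorm_lt (σ i)) (norm_nonneg _) two_ne_zero
      unfold disc
      nlinarith [sq_nonneg ((y i) 2)]
    have hcos : ∀ i, Real.cos (θ i) = cf r (y i) := fun i => cos_angf (hyD i)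
    have hsin : ∀ i, Real.sin (θ i) = sf r (y i) := fun i => sin_angf (hyD i)
    -- gaps
    obtain ⟨φ, hφ0, hφsum, hφpart⟩ :=
      gaps θ hθmono (fun i => (angf_mem r (y i)).1) (fun i => (angf_mem r (y i)).2)
    have hA1 : ∀ i, θ 0 + ∑ j, (if j < i then φ j else 0) = θ i := fun i => by
      rw [hφpart]; ring
    have hA2 : ∀ i, θ 0 + Real.pi + ∑ j, (if j < i then φ j else 0) = θ i + Real.pi := fun i => by
      rw [hφpart]; ring
    -- the disc parameters
    set p : Fin (m + 1) → ℝ × ℝ × ℝ := fun i => (φ i, af r (y i), bf r (y i)) with hp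
    have hab : ∀ i, 0 < af r (y i) ^ 2 + bf r (y i) ^ 2 ∧ af r (y i) ^ 2 + bf r (y i) ^ 2 < r ^ 2 := by
      intro i
      obtain ⟨-, -, -, -, htpos, htlt, -, -⟩ := core hr (hyρ i) (hyD i)
      rw [af_sq_add_bf_sq hr (hyρ i) (hyD i)]
      refine ⟨by positivity, ?_⟩
      have : tf r (y i) ^ 2 < 1 := by nlinarith
      nlinarith
    -- membership in the disc domain (offset-free conditions)
    have hdom : (θ 0, p) ∈ {q : ℝ × (Fin (m + 1) → ℝ × ℝ × ℝ) |
        (∀ i, 0 ≤ (q.2 i).1 ∧ 0 < (q.2 i).2.1 ^ 2 + (q.2 i).2.2 ^ 2 ∧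
          (q.2 i).2.1 ^ 2 + (q.2 i).2.2 ^ 2 < r ^ 2) ∧ ∑ i, (q.2 i).1 = 2 * Real.pi ∧
        (fun i : Fin (m + 1) => (!₂[(2 / ((1 + (((q.2 i).2.1 ^ 2 + (q.2 i).2.2 ^ 2) / r ^ 2)) +
          (1 - (((q.2 i).2.1 ^ 2 + (q.2 i).2.2 ^ 2) / r ^ 2)) *
            Real.cos (∑ j : Fin (m + 1), if j < i then (q.2 j).1 else 0))) * (q.2 i).2.1,
          (2 / ((1 + (((q.2 i).2.1 ^ 2 + (q.2 i).2.2 ^ 2) / r ^ 2)) +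
          (1 - (((q.2 i).2.1 ^ 2 + (q.2 i).2.2 ^ 2) / r ^ 2)) *
            Real.cos (∑ j : Fin (m + 1), if j < i then (q.2 j).1 else 0))) * (q.2 i).2.2,
          -(r / 2) * (1 - (((q.2 i).2.1 ^ 2 + (q.2 i).2.2 ^ 2) / r ^ 2)) *
            Real.sin (∑ j : Fin (m + 1), if j < i then (q.2 j).1 else 0) *
            (2 / ((1 + (((q.2 i).2.1 ^ 2 + (q.2 i).2.2 ^ 2) / r ^ 2)) +
              (1 - (((q.2 i).2.1 ^ 2 + (q.2 i).2.2 ^ 2) / r ^ 2)) *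
                Real.cos (∑ j : Fin (m + 1), if j < i then (q.2 j).1 else 0)))] :
            EuclideanSpace ℝ (Fin 3))) ∈ NonCoincident 3 (m + 1)} := by
      refine ⟨fun i => ⟨hφ0 i, (hab i).1, (hab i).2⟩, hφsum, ?_⟩
      show Function.Injective (fun i => Mf r (Real.cos (∑ j, if j < i then φ j else 0))
        (Real.sin (∑ j, if j < i then φ j else 0)) (af r (y i)) (bf r (y i)))
      simp only [hφpart]
      intro i j hij
      have hcs : ∀ k, Real.cos (θ k - θ 0) ^ 2 + Real.sin (θ k - θ 0) ^ 2 = 1 := fun k =>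
        Real.cos_sq_add_sin_sq _
      obtain ⟨hc, hs, ha, hb⟩ := Mf_injective hr (hcs i) (hab i).1 (hab i).2 (hcs j) (hab j).1
        (hab j).2 hij
      apply hyinj
      rw [← Mf_cf_sf hr (hyρ i) (hyD i), ← Mf_cf_sf hr (hyρ j) (hyD j), ← hcos, ← hcos, ← hsin,
        ← hsin, show θ i = θ i - θ 0 + θ 0 by ring, show θ j = θ j - θ 0 + θ 0 by ring,
        Real.cos_add, Real.sin_add, Real.cos_add, Real.sin_add, hc, hs, ha, hb]
    -- the hypothesis at offsets θ₀ and θ₀ + π, in folded form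
    have key : (∏ i, Jf r (Real.cos (θ 0 + ∑ j, if j < i then φ j else 0)) (af r (y i))
        (bf r (y i))) ^ Δ * S (m + 1) (fun i => Mf r (Real.cos (θ 0 + ∑ j, if j < i then φ j else 0))
        (Real.sin (θ 0 + ∑ j, if j < i then φ j else 0)) (af r (y i)) (bf r (y i))) =
        (∏ i, Jf r (Real.cos (θ 0 + Real.pi + ∑ j, if j < i then φ j else 0)) (af r (y i))
        (bf r (y i))) ^ Δ * S (m + 1) (fun i => Mf r
        (Real.cos (θ 0 + Real.pi + ∑ j, if j < i then φ j else 0))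
        (Real.sin (θ 0 + Real.pi + ∑ j, if j < i then φ j else 0)) (af r (y i)) (bf r (y i))) :=
      H r hr (m + 1) (θ 0) (θ 0 + Real.pi) p hdom
    simp only [hA1, hA2, Real.cos_add_pi, Real.sin_add_pi, hcos, hsin] at key
    have hM1 : (fun i => Mf r (cf r (y i)) (sf r (y i)) (af r (y i)) (bf r (y i))) = y :=
      funext fun i => Mf_cf_sf hr (hyρ i) (hyD i)
    have hM2 : (fun i => Mf r (-cf r (y i)) (-sf r (y i)) (af r (y i)) (bf r (y i))) =
        fun i => (r ^ 2 / nsq (y i)) • axisReflection 2 (y i) :=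
      funext fun i => Mf_neg_cf_neg_sf hr (hyρ i) (hyD i)
    have hJ1 : ∏ i, Jf r (cf r (y i)) (af r (y i)) (bf r (y i)) =
        ∏ i, rho (y i) / (r * tf r (y i)) :=
      Finset.prod_congr rfl fun i _ => Jf_cf hr (hyρ i) (hyD i)
    have hJ2 : ∏ i, Jf r (-cf r (y i)) (af r (y i)) (bf r (y i)) =
        ∏ i, (rho (y i) / (r * tf r (y i)) * (r ^ 2 / nsq (y i))) :=
      Finset.prod_congr rfl fun i _ => Jf_neg_cf hr (hyρ i) (hyD i)
    rw [hM1, hM2, hJ1, hJ2] at key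
    -- the inverted configuration: `(r²/‖y‖²) θ₂ y = r² · θ₂ (ι y)`
    have hS2 : S (m + 1) (fun i => (r ^ 2 / nsq (y i)) • axisReflection 2 (y i)) =
        (r ^ 2) ^ (-((m + 1 : ℕ) : ℝ) * Δ) * S (m + 1) (fun i => inversion 0 1 (y i)) := by
      have hfun : (fun i => (r ^ 2 / nsq (y i)) • axisReflection 2 (y i)) =
          fun i => (r ^ 2) • axisReflection 2 (inversion 0 1 (y i)) := by
        funext i
        rw [inversion_zero_one_eq, LinearIsometryEquiv.map_smul, smul_smul, ← nsq_eq_norm_sq,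
          div_eq_mul_inv]
      rw [hfun]
      calc S (m + 1) (fun i => (r ^ 2) • axisReflection 2 (inversion 0 1 (y i)))
          = (r ^ 2) ^ (-((m + 1 : ℕ) : ℝ) * Δ) *
              S (m + 1) (fun i => axisReflection 2 (inversion 0 1 (y i))) :=
            hsc (m + 1) (r ^ 2) hr2 (fun i => axisReflection 2 (inversion 0 1 (y i)))
        _ = (r ^ 2) ^ (-((m + 1 : ℕ) : ℝ) * Δ) * S (m + 1) (fun i => inversion 0 1 (y i)) := by
            rw [hrot (m + 1) (axisReflection 2) (fun i => inversion 0 1 (y i))]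
    rw [hS2] at key
    have hf : ∀ i, 0 < rho (y i) / (r * tf r (y i)) := by
      intro i
      obtain ⟨hρpos, -, -, -, htpos, -, -, -⟩ := core hr (hyρ i) (hyD i)
      positivity
    have main := bookkeeping hr2 _ _ hf hynsq key
    -- main : S (m+1) (ι ∘ y) = (∏ i, nsq (y i) ^ Δ) * S (m+1) y
    -- transport back to `x`
    have e1 : S (m + 1) y = S (m + 1) x := by
      calc S (m + 1) y = S (m + 1) ((fun i => R (x i)) ∘ σ) := rfl
        _ = S (m + 1) (fun i => R (x i)) := perm_symm hlim hnorm _ σ _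
        _ = S (m + 1) x := hrot _ R x
    have e2 : S (m + 1) (fun i => inversion 0 1 (y i)) =
        S (m + 1) (fun i => inversion 0 1 (x i)) := by
      calc S (m + 1) (fun i => inversion 0 1 (y i))
          = S (m + 1) ((fun i => R (inversion 0 1 (x i))) ∘ σ) := by
            congr 1
            funext i
            exact inversion_map R (x (σ i))
        _ = S (m + 1) (fun i => R (inversion 0 1 (x i))) := perm_symm hlim hnorm _ σ _
        _ = S (m + 1) (fun i => inversion 0 1 (x i)) := hrot _ R _
    have e3 : ∏ i, nsq (y i) ^ Δ = ∏ i, ‖x i‖ ^ (2 * Δ) := by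
      calc ∏ i, nsq (y i) ^ Δ = ∏ i, ‖x (σ i)‖ ^ (2 * Δ) := by
            refine Finset.prod_congr rfl fun i _ => ?_
            rw [nsq_eq_norm_sq, show y i = R (x (σ i)) from rfl, LinearIsometryEquiv.norm_map,
              Real.rpow_mul (norm_nonneg _), Real.rpow_two]
        _ = ∏ i, ‖x i‖ ^ (2 * Δ) := Equiv.prod_comp σ (fun i => ‖x i‖ ^ (2 * Δ))
    rw [← e2, main, e3, e1]

end Upgrade

end Summit.CriticalPhenomena.Ising3DConformalLimit.ModularQuarterTurnToroidal

end
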